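import Literature.AlgebraicGeometry.Motives.SchemeOverDominant
import Literature.AlgebraicGeometry.Motives.GrpObjOfAlgPoints
import Literature.AlgebraicGeometry.Motives.AbelianVarietyProofs
import Literature.AlgebraicGeometry.Motives.AbelianVarietyMulN
import Literature.AlgebraicGeometry.Motives.GenericFibre
import HarnessLib

/-!
# The image of a homomorphism of abelian varieties is an abelian subvariety

For a homomorphism `f : X → Y` of abelian varieties over a field `K`, the scheme-theoretic image
`im f ⊆ Y` (Mathlib `Scheme.Hom.image`, `Scheme.Hom.imageι`, `Scheme.Hom.toImage`) is an abelian
variety, `im f ↪ Y` is a homomorphism and a closed immersion, `X ↠ im f` is a surjective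
homomorphism, and `f = (X ↠ im f) ≫ (im f ↪ Y)` (Mumford, *Abelian Varieties*, §19, p. 173:
images of homomorphisms are abelian subvarieties — used in the proofs of Thm. 1 and of Cor. 2 of
Thm. 1; Milne 1986, §12, proof of Prop. 12.1). Everything here is proved:

* `AbelianVariety.imageOver f`, `imageιOver f`, `toImageOver f` — the image as a `K`-scheme with
  its two `K`-morphisms; `im f → Spec K` is proper, separated, of finite type, and **geometrically
  integral** (`geometricallyIntegral_imageOver_hom`: `X ↠ im f` is surjective and
  scheme-theoretically dominant, `SchemeOver.geometricallyIntegral_of_isSchemeTheoreticallyDominant` of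
  `Motives/SchemeOverDominant`);
* `AbelianVariety.imageOne/imageMul/imageInv` — the group operations of `Y` restrict to `im f`:
  lifts through the closed immersion `im f ↪ Y` (Mathlib `IsClosedImmersion.lift`), the kernel
  conditions holding because `X → im f`, `X × X → im f × im f` are scheme-theoretically dominant and
  `f` is a homomorphism (`ker_imageι_le_ker_one/mul/inv`);
* `AbelianVariety.imageGrpObj f` — the group-scheme axioms, checked on `K̄`-points inside `Y(K̄)`
  (`GrpObj.ofAlgPointsOfInjective`, `Motives/GrpObjOfAlgPoints`);
* `AbelianVariety.image f : AbelianVariety K`, `AbelianVariety.imageι f : image f ⟶ Y`,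
  `AbelianVariety.toImage f : X ⟶ image f`, `toImage_imageι : toImage f ≫ imageι f = f`, with
  `IsClosedImmersion (imageι f)` and `Surjective (toImage f)` on underlying schemes.

Dimension statements (`dim (im f) ≤ dim X, dim Y`, `f ≠ 0 ⇒ 0 < dim (im f)`) and the consequence
"a non-zero homomorphism to a simple abelian variety is surjective" are in
`Motives/AbelianVarietyImageSimpleProofs`.

Mathlib searched (pin): `Scheme.Hom.image/imageι/toImage`, `toImage_imageι`,
`IsClosedImmersion.lift/lift_fac`, `IsClosedImmersion I.subschemeι`, `UniversallyClosed f.toImage`,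
`IsMonHom.one_hom/mul_hom`, `GrpObj.inv_hom`, `Grp.homMk''`, `tensorHom_comp_tensorHom` (used);
Mathlib has no abelian (sub)varieties.

## References

* D. Mumford, *Abelian Varieties*, TIFR Studies in Mathematics 5, OUP (1970): §19, Thm. 1 and
  Cor. 2 (pp. 173–174 of the 2nd ed.; not held — architecture as in Milne 1986). [MumfordAV1970]
* J. S. Milne, *Abelian Varieties*, in Cornell–Silverman (eds.), *Arithmetic Geometry*, Springer
  1986, §12, Prop. 12.1 and its proof (held: `book:cornellnd-arithmetic-geometry`, PDF p. 189).
  [Milne1986AbelianVarieties]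

## Design

`imageOver`, `imageιOver`, `toImageOver` are `abbrev`s (so that Mathlib's instances for
`Scheme.Hom.imageι`, `Scheme.Hom.toImage` are found on their underlying scheme morphisms); the
lifted operations are first defined on underlying schemes (`imageOneLeft`, …) with explicit types,
then packaged as `K`-morphisms. `image f` is a plain `def` (its `GrpObj` instance is the field
`grpObj`, found through `AbelianVariety.grpObj`).
-/

universe u

open CategoryTheory CategoryTheory.Limits AlgebraicGeometry MonoidalCategory CartesianMonoidalCategory

noncomputable section

namespace Literature.AlgebraicGeometry.Motives

open scoped MonObj

variable {K : Type u} [Field K]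

namespace AbelianVariety

variable {X Y : AbelianVariety K} (f : X ⟶ Y)

/-- Homomorphisms of abelian varieties are quasi-compact (they are proper,
`isProper_toSchemeHom`). [folklore] -/
instance quasiCompact_toSchemeHom : QuasiCompact (Hom.toSchemeHom f) := by
  haveI := Literature.AlgebraicGeometry.Motives.AbelianVariety.isProper_toSchemeHom f; infer_instance

/-- Homomorphisms of abelian varieties are universally closed (they are proper). [folklore] -/
instance universallyClosed_toSchemeHom : UniversallyClosed (Hom.toSchemeHom f) := by
  haveI := Literature.AlgebraicGeometry.Motives.AbelianVariety.isProper_toSchemeHom f; infer_instance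

/-- The scheme-theoretic image of a homomorphism of abelian varieties, as a `K`-scheme.
[folklore] -/
abbrev imageOver : SchemeOver K := Over.mk ((Hom.toSchemeHom f).imageι ≫ Y.X.hom)

/-- The inclusion of the image, a `K`-morphism. [folklore] -/
abbrev imageιOver : imageOver f ⟶ Y.X := Over.homMk (Hom.toSchemeHom f).imageι rfl

/-- The corestriction `X → im f`, a `K`-morphism. [folklore] -/
abbrev toImageOver : X.X ⟶ imageOver f :=
  Over.homMk (Hom.toSchemeHom f).toImage (by
    change (Hom.toSchemeHom f).toImage ≫ (Hom.toSchemeHom f).imageι ≫ Y.X.hom = X.X.hom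
    rw [Scheme.Hom.toImage_imageι_assoc]
    exact Over.w f.hom.hom.hom)

/-- On schemes, `im f ↪ Y` is Mathlib's `Scheme.Hom.imageι`. [folklore] -/
@[simp] theorem imageιOver_left : (imageιOver f).left = (Hom.toSchemeHom f).imageι := rfl

/-- On schemes, `X ↠ im f` is Mathlib's `Scheme.Hom.toImage`. [folklore] -/
@[simp] theorem toImageOver_left : (toImageOver f).left = (Hom.toSchemeHom f).toImage := rfl

/-- The structure morphism of `im f` is `im f ↪ Y → Spec K`. [folklore] -/
theorem imageOver_hom : (imageOver f).hom = (Hom.toSchemeHom f).imageι ≫ Y.X.hom := rfl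

/-- `X ↠ im f ↪ Y` is `f` (as `K`-morphisms). [folklore] -/
@[reassoc (attr := simp)]
theorem toImageOver_imageιOver : toImageOver f ≫ imageιOver f = f.hom.hom.hom := by
  ext1; exact (Hom.toSchemeHom f).toImage_imageι

/-- `im f ↪ Y` is a closed immersion. [folklore] -/
instance isClosedImmersion_imageιOver_left : IsClosedImmersion (imageιOver f).left := by
  change IsClosedImmersion (Hom.toSchemeHom f).imageι; infer_instance

/-- `im f ↪ Y` is a monomorphism of `K`-schemes. [folklore] -/
instance mono_imageιOver : Mono (imageιOver f) := (Over.forget _).mono_of_mono_map (by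
  change Mono (Hom.toSchemeHom f).imageι; infer_instance)

/-- `X ↠ im f` is scheme-theoretically dominant (`f` is quasi-compact). [folklore] -/
instance isSchemeTheoreticallyDominant_toImageOver_left :
    IsSchemeTheoreticallyDominant (toImageOver f).left := by
  change IsSchemeTheoreticallyDominant (Hom.toSchemeHom f).toImage
  exact isSchemeTheoreticallyDominant_toImage _

/-- `X ↠ im f` is quasi-compact. [folklore] -/
instance quasiCompact_toImageOver_left : QuasiCompact (toImageOver f).left := by
  change QuasiCompact (Hom.toSchemeHom f).toImage; infer_instance

/-- `X ↠ im f` is surjective (`X` is proper, so the dense image is closed). [folklore] -/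
instance surjective_toImageOver_left : Surjective (toImageOver f).left := by
  change Surjective (Hom.toSchemeHom f).toImage
  exact Surjective.of_universallyClosed_of_isDominant _

/-- **`im f` is geometrically integral over `K`**, being dominated scheme-theoretically by the
geometrically integral `X` (`geometricallyIntegral_of_isSchemeTheoreticallyDominant`). [folklore] -/
instance geometricallyIntegral_imageOver_hom : GeometricallyIntegral (imageOver f).hom :=
  SchemeOver.geometricallyIntegral_of_isSchemeTheoreticallyDominant (toImageOver f)

/-- `im f → Spec K` is proper (closed in the proper `Y`). [folklore] -/
instance isProper_imageOver_hom : IsProper (imageOver f).hom := by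
  change IsProper ((Hom.toSchemeHom f).imageι ≫ Y.X.hom); infer_instance

/-- `im f → Spec K` is locally of finite type. [folklore] -/
instance locallyOfFiniteType_imageOver_hom : LocallyOfFiniteType (imageOver f).hom := by
  change LocallyOfFiniteType ((Hom.toSchemeHom f).imageι ≫ Y.X.hom); infer_instance

/-- `im f → Spec K` is separated. [folklore] -/
instance isSeparated_imageOver_hom : IsSeparated (imageOver f).hom := by
  change IsSeparated ((Hom.toSchemeHom f).imageι ≫ Y.X.hom); infer_instance


/-! ### The group operations of `Y` restrict to the image -/

/-- The kernel of `im f ↪ Y` is contained in the kernel of the unit `Spec K → Y`. [folklore] -/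
theorem ker_imageι_le_ker_one :
    (Hom.toSchemeHom f).imageι.ker ≤ (η[Y.X]).left.ker := by
  have h : (η[Y.X]).left =
      ((η[X.X]).left ≫ (Hom.toSchemeHom f).toImage) ≫ (Hom.toSchemeHom f).imageι := by
    rw [Category.assoc, Scheme.Hom.toImage_imageι, ← IsMonHom.one_hom f.hom.hom.hom]; rfl
  rw [h]; exact Scheme.Hom.le_ker_comp _ _


/-- The kernel of `im f ↪ Y` is contained in the kernel of `im f × im f → Y × Y → Y`. [folklore] -/
theorem ker_imageι_le_ker_mul :
    (Hom.toSchemeHom f).imageι.ker ≤ ((imageιOver f ⊗ₘ imageιOver f) ≫ μ[Y.X]).left.ker := by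
  have h : (toImageOver f ⊗ₘ toImageOver f) ≫ (imageιOver f ⊗ₘ imageιOver f) ≫ μ[Y.X] =
      (μ[X.X] ≫ toImageOver f) ≫ imageιOver f := by
    rw [tensorHom_comp_tensorHom_assoc, toImageOver_imageιOver, Category.assoc,
      toImageOver_imageιOver, IsMonHom.mul_hom]
  have h2 : (toImageOver f ⊗ₘ toImageOver f).left ≫ ((imageιOver f ⊗ₘ imageιOver f) ≫ μ[Y.X]).left =
      (μ[X.X] ≫ toImageOver f).left ≫ (imageιOver f).left := by
    rw [← Over.comp_left, ← Over.comp_left, h]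
  haveI := SchemeOver.isSchemeTheoreticallyDominant_tensorHom_left (toImageOver f)
  have e : ((toImageOver f ⊗ₘ toImageOver f).left ≫
      ((imageιOver f ⊗ₘ imageιOver f) ≫ μ[Y.X]).left).ker =
      ((imageιOver f ⊗ₘ imageιOver f) ≫ μ[Y.X]).left.ker := by
    rw [Scheme.Hom.ker_comp, IsSchemeTheoreticallyDominant.ker_eq_bot,
      Scheme.IdealSheafData.map_bot]
  rw [← e, h2]
  exact Scheme.Hom.le_ker_comp _ _

/-- The kernel of `im f ↪ Y` is contained in the kernel of `im f → Y → Y`, `y ↦ -y`. [folklore] -/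
theorem ker_imageι_le_ker_inv :
    (Hom.toSchemeHom f).imageι.ker ≤ (imageιOver f ≫ ι[Y.X]).left.ker := by
  have h : toImageOver f ≫ imageιOver f ≫ ι[Y.X] = (ι[X.X] ≫ toImageOver f) ≫ imageιOver f := by
    rw [toImageOver_imageιOver_assoc, Category.assoc, toImageOver_imageιOver, GrpObj.inv_hom]
  have h2 : (toImageOver f).left ≫ (imageιOver f ≫ ι[Y.X]).left =
      (ι[X.X] ≫ toImageOver f).left ≫ (imageιOver f).left := by
    rw [← Over.comp_left, ← Over.comp_left, h]
  have e : ((toImageOver f).left ≫ (imageιOver f ≫ ι[Y.X]).left).ker =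
      (imageιOver f ≫ ι[Y.X]).left.ker := by
    rw [Scheme.Hom.ker_comp, IsSchemeTheoreticallyDominant.ker_eq_bot,
      Scheme.IdealSheafData.map_bot]
  rw [← e, h2]
  exact Scheme.Hom.le_ker_comp _ _

/-- The unit of the image on underlying schemes: `Spec K → im f`. [folklore] -/
def imageOneLeft : Spec (.of K) ⟶ (Hom.toSchemeHom f).image :=
  IsClosedImmersion.lift (Hom.toSchemeHom f).imageι (η[Y.X]).left (ker_imageι_le_ker_one f)

/-- The multiplication of the image on underlying schemes. [folklore] -/
def imageMulLeft : pullback (imageOver f).hom (imageOver f).hom ⟶ (Hom.toSchemeHom f).image :=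
  IsClosedImmersion.lift (Hom.toSchemeHom f).imageι
    ((imageιOver f ⊗ₘ imageιOver f) ≫ μ[Y.X]).left (ker_imageι_le_ker_mul f)

/-- The inverse of the image on underlying schemes. [folklore] -/
def imageInvLeft : (Hom.toSchemeHom f).image ⟶ (Hom.toSchemeHom f).image :=
  IsClosedImmersion.lift (Hom.toSchemeHom f).imageι (imageιOver f ≫ ι[Y.X]).left
    (ker_imageι_le_ker_inv f)

/-- The unit of `im f` followed by `im f ↪ Y` is the unit of `Y`. [folklore] -/
@[reassoc (attr := simp)]
theorem imageOneLeft_imageι : imageOneLeft f ≫ (Hom.toSchemeHom f).imageι = (η[Y.X]).left :=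
  IsClosedImmersion.lift_fac _ _ _

/-- The multiplication of `im f` followed by `im f ↪ Y`. [folklore] -/
@[reassoc (attr := simp)]
theorem imageMulLeft_imageι :
    imageMulLeft f ≫ (Hom.toSchemeHom f).imageι = ((imageιOver f ⊗ₘ imageιOver f) ≫ μ[Y.X]).left :=
  IsClosedImmersion.lift_fac _ _ _

/-- The inverse of `im f` followed by `im f ↪ Y`. [folklore] -/
@[reassoc (attr := simp)]
theorem imageInvLeft_imageι :
    imageInvLeft f ≫ (Hom.toSchemeHom f).imageι = (imageιOver f ≫ ι[Y.X]).left :=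
  IsClosedImmersion.lift_fac _ _ _

/-- The unit of the image: `Spec K → im f`, the lift of the unit of `Y`. [folklore] -/
def imageOne : 𝟙_ (SchemeOver K) ⟶ imageOver f :=
  Over.homMk (imageOneLeft f) (by
    change imageOneLeft f ≫ (Hom.toSchemeHom f).imageι ≫ Y.X.hom = _
    rw [imageOneLeft_imageι_assoc]; exact Over.w _)

/-- The multiplication of the image, the lift of `im f × im f → Y × Y → Y`. [folklore] -/
def imageMul : imageOver f ⊗ imageOver f ⟶ imageOver f :=
  Over.homMk (imageMulLeft f) (by
    change imageMulLeft f ≫ (Hom.toSchemeHom f).imageι ≫ Y.X.hom = _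
    rw [imageMulLeft_imageι_assoc]; exact Over.w _)

/-- The inverse of the image, the lift of `im f → Y → Y`. [folklore] -/
def imageInv : imageOver f ⟶ imageOver f :=
  Over.homMk (imageInvLeft f) (by
    change imageInvLeft f ≫ (Hom.toSchemeHom f).imageι ≫ Y.X.hom = _
    rw [imageInvLeft_imageι_assoc]; exact Over.w _)

/-- `im f ↪ Y` respects units. [folklore] -/
@[reassoc (attr := simp)]
theorem imageOne_imageιOver : imageOne f ≫ imageιOver f = η[Y.X] := by
  ext1; exact imageOneLeft_imageι f

/-- `im f ↪ Y` respects multiplication. [folklore] -/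
@[reassoc (attr := simp)]
theorem imageMul_imageιOver :
    imageMul f ≫ imageιOver f = (imageιOver f ⊗ₘ imageιOver f) ≫ μ[Y.X] := by
  ext1; exact imageMulLeft_imageι f

/-- `im f ↪ Y` respects inverses. [folklore] -/
@[reassoc (attr := simp)]
theorem imageInv_imageιOver : imageInv f ≫ imageιOver f = imageιOver f ≫ ι[Y.X] := by
  ext1; exact imageInvLeft_imageι f

/-- **The image of a homomorphism of abelian varieties is a group scheme**: the group axioms hold
on `K̄`-points because they hold in `Y(K̄)`, into which `(im f)(K̄)` embeds compatibly.
[folklore] -/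
@[implicit_reducible]
def imageGrpObj : GrpObj (imageOver f) :=
  GrpObj.ofAlgPointsOfInjective (Ω := AlgebraicClosure K) (mul := imageMul f) (one := imageOne f)
    (inv := imageInv f) (G := Additive (AlgPoints Y.X (AlgebraicClosure K)))
    (fun P => Additive.ofMul (P ≫ imageιOver f))
    (fun P Q h => (cancel_mono (imageιOver f)).1 (Additive.ofMul.injective h))
    (fun P Q => by
      rw [← ofMul_mul]
      congr 1
      rw [Category.assoc, imageMul_imageιOver, lift_map_assoc]
      rfl)
    (by rw [← ofMul_one]; congr 1; rw [Category.assoc, imageOne_imageιOver]; rfl)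
    (fun P => by
      rw [← ofMul_inv]; congr 1; rw [Category.assoc, imageInv_imageιOver]; rfl)

/-! ### The image abelian variety and the factorisation `X ↠ im f ↪ Y` -/

/-- **The image of a homomorphism of abelian varieties is an abelian variety** (Mumford, *Abelian
Varieties*, §19, proof of Thm. 1 / p. 173: images of homomorphisms are abelian subvarieties;
Milne 1986, §12): the scheme-theoretic image of `f : X → Y` with the group law of `Y`, proper
(closed in `Y`) and geometrically integral (dominated scheme-theoretically by `X`).
[cite: MumfordAV1970, §19 (p. 173)] -/
def image : AbelianVariety K where
  X := imageOver f
  grpObj := imageGrpObj f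
  isProper := isProper_imageOver_hom f
  geometricallyIntegral := geometricallyIntegral_imageOver_hom f

/-- The underlying `K`-scheme of `im f` is the scheme-theoretic image. [folklore] -/
theorem image_X : (image f).X = imageOver f := rfl

/-- The unit of `im f` is `imageOne`. [folklore] -/
theorem image_one : η[(image f).X] = imageOne f := rfl

/-- The multiplication of `im f` is `imageMul`. [folklore] -/
theorem image_mul : μ[(image f).X] = imageMul f := rfl

/-- `X ↠ im f` respects units. [folklore] -/
theorem one_toImageOver : η[X.X] ≫ toImageOver f = imageOne f := by
  rw [← cancel_mono (imageιOver f), Category.assoc, toImageOver_imageιOver, imageOne_imageιOver,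
    IsMonHom.one_hom]

/-- `X ↠ im f` respects multiplication. [folklore] -/
theorem mul_toImageOver :
    μ[X.X] ≫ toImageOver f = (toImageOver f ⊗ₘ toImageOver f) ≫ imageMul f := by
  rw [← cancel_mono (imageιOver f), Category.assoc, toImageOver_imageιOver, Category.assoc,
    imageMul_imageιOver, tensorHom_comp_tensorHom_assoc, toImageOver_imageιOver, IsMonHom.mul_hom]

/-- The inclusion `im f ↪ Y`, a homomorphism of abelian varieties and a closed immersion.
[folklore] -/
def imageι : image f ⟶ Y :=
  InducedCategory.homMk (Grp.homMk'' (A := (image f).toGrp) (B := Y.toGrp) (imageιOver f)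
    (imageOne_imageιOver f) (imageMul_imageιOver f))

/-- The corestriction `X ↠ im f`, a surjective homomorphism of abelian varieties. [folklore] -/
def toImage : X ⟶ image f :=
  InducedCategory.homMk (Grp.homMk'' (A := X.toGrp) (B := (image f).toGrp) (toImageOver f)
    (one_toImageOver f) (mul_toImageOver f))

/-- On schemes, `imageι f` is Mathlib's `Scheme.Hom.imageι`. [folklore] -/
theorem toSchemeHom_imageι : Hom.toSchemeHom (imageι f) = (Hom.toSchemeHom f).imageι := rfl

/-- On schemes, `toImage f` is Mathlib's `Scheme.Hom.toImage`. [folklore] -/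
theorem toSchemeHom_toImage : Hom.toSchemeHom (toImage f) = (Hom.toSchemeHom f).toImage := rfl

/-- **`f` factors as `X ↠ im f ↪ Y`.** [folklore] -/
@[reassoc (attr := simp)]
theorem toImage_imageι : toImage f ≫ imageι f = f :=
  Literature.AlgebraicGeometry.Motives.AbelianVariety.hom_ext _ _ (toImageOver_imageιOver f)

/-- **`im f ↪ Y` is a closed immersion.** [folklore] -/
instance isClosedImmersion_toSchemeHom_imageι : IsClosedImmersion (Hom.toSchemeHom (imageι f)) := by
  exact (inferInstance : IsClosedImmersion (Hom.toSchemeHom f).imageι)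

/-- `im f ↪ Y` is universally closed. [folklore] -/
instance universallyClosed_toSchemeHom_imageι : UniversallyClosed (Hom.toSchemeHom (imageι f)) := by
  exact (inferInstance : UniversallyClosed (Hom.toSchemeHom f).imageι)

/-- **`X ↠ im f` is surjective.** [folklore] -/
instance surjective_toSchemeHom_toImage : Surjective (Hom.toSchemeHom (toImage f)) := by
  exact Surjective.of_universallyClosed_of_isDominant (Hom.toSchemeHom f).toImage

/-- `X ↠ im f` is universally closed. [folklore] -/
instance universallyClosed_toSchemeHom_toImage : UniversallyClosed (Hom.toSchemeHom (toImage f)) := by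
  exact (inferInstance : UniversallyClosed (Hom.toSchemeHom f).toImage)


end AbelianVariety

end Literature.AlgebraicGeometry.Motives
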